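/-
Copyright (c) 2026. All rights reserved.
Released under Apache 2.0 license as described in the file LICENSE.
Authors: abc-iut cell, seat abc-iut-w5-d226 (gen 4; cone node `AbsTopIII:Prop4.2(ii)` — the printed item
(ii) at the archimedean models of [AbsTopIII] §4 with ZERO binders, for all four types `T`).
-/
import Literature.AnabelianGeometry.AbsoluteAnabelian.ArchimedeanHolMonoidPairsLogFrobenius
import Literature.AnabelianGeometry.AbsoluteAnabelian.AbsTopIII.AutHolLogFrobeniusGaloisModel
import Literature.AnabelianGeometry.AbsoluteAnabelian.ArchimedeanHolFieldFunctorGeometric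
import HarnessLib

/-!
# [AbsTopIII] Prop 4.2 (ii) — the factorisation of `𝔩𝔬𝔤_{TF,T}` through `𝒞^hol_TM` and `𝔩𝔬𝔤_{T,T} ≅ id` —
# CLOSED at the archimedean models for EVERY interface datum, zero binders

S. Mochizuki, *Topics in Absolute Anabelian Geometry III*, Prop 4.2 (ii), kurims manuscript p. 105
l. 75 – p. 106 l. 7, proof p. 106 l. 25–26 (lit key `paper:url-5493eb38cbb7`, read on the page; bib key
`MochizukiAbsTopIII2015`):

> (ii) The equivalence of categories `κ_LH : EA ⥲ LinHol` of Definition 4.1, (v) — i.e., the functorial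
> algorithms of Corollary 2.7 — determines a natural [1-]factorization [cf. Proposition 3.2, (v)]
> `𝒞^hol_TF → 𝒞^hol_TM →^{𝔩𝔬𝔤_{TM,T}} 𝒞^hol_T` — where `T ∈ {TF, TLG, TCG, TM}`; the first arrow is the
> natural functor of Definition 4.1, (iii) — of the log-Frobenius functors `𝔩𝔬𝔤_{TF,T} : 𝒞^hol_TF → 𝒞^hol_T`
> of Definition 4.1, (iv).  Moreover, [when `T ∈ {TF, TM}`] the functor `𝔩𝔬𝔤_{T,T}` is isomorphic to the
> identity functor [hence, in particular, is an equivalence of categories].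
>
> Proof. … Assertion (ii) follows immediately from the definitions [and the functorial algorithms of
> Corollary 2.7].

PROOF-ONLY companion (abc-iut cell, cone node `AbsTopIII:Prop4.2(ii)`; no notion is declared) of the
typer's landed files: abc-iut-L4-t14's `ArchimedeanLogFrobeniusFunctors.lean` (where item (ii) is typed
only as its object-level shadow `logFrobeniusTF_pair`, `linHolPair`, "NOT typed as the printed natural
isomorphism (the categories are not packaged)") and the sub-DAG statements file
`ArchimedeanLogFrobeniusProp42Sub.lean` (plan/L4/SUBDAG-AbsTopIII-Prop42.md rows P42.ii/L13–L14).  The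
categories ARE packaged at the archimedean MODEL of §4 over the Cor 2.7 (e)+functoriality interface
`𝔄 : AutHolFieldFunctor` — "the functorial algorithms of Corollary 2.7" of the printed sentence IS that
interface datum: `𝒞^hol_TF = HolTFPair 𝔄` (abc-iut-L4-t10), `𝒞^hol_T = HolMonoidPair 𝔄 T` for the monoid
types `T ∈ {TM, TLG, TCG}` (abc-iut-w5-d226), `LinHol 𝔄`, `κ_LH`, `φ_LH`, `𝔩𝔬𝔤_{TF,TF} = HolTFPair.logFunctor`,
`𝔩𝔬𝔤_{TF,T} = HolMonoidPair.logTF`, `𝔩𝔬𝔤_{TM,TF} = logTMTF := (𝒞^hol_TM → EA) ⋙ κ_LH ⋙ φ_LH ⋙ 𝔩𝔬𝔤_{TF,TF}`,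
`𝔩𝔬𝔤_{TM,T} = logTM`.  Here the printed clauses of (ii) are CLOSED, clause by clause and as one
conjunction, for EVERY `𝔄` with NO further hypothesis, and then read at the tree's three model
families of the interface (constant field, Galois category `B(Π)` — no slimness needed for (ii) —, and
abc-iut-L4-t14's GEOMETRIC `EA^hol_RS(Q)` of connected Riemann surfaces, in particular print's
elliptically admissible hyperbolic orbicurves — no id-rigidity / Lemma 4.3 input, which serve item (i)
only):

* (ii-a) "`κ_LH` … determines" — `𝔩𝔬𝔤_{TM,TF}` IS the composite through `κ_LH` (`logTMTF_eq`, `rfl`);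
* (ii-b) the factorisation `𝒞^hol_TF → 𝒞^hol_TM →^{𝔩𝔬𝔤_{TM,T}} 𝒞^hol_T ≅ 𝔩𝔬𝔤_{TF,T}` for `T = TF`
  (`HolMonoidPair.logFactorTF`) and for `T ∈ {TM, TLG, TCG}` (`HolMonoidPair.logFactor`), the first arrow
  the natural functor `ofTF` of Def 4.1 (iii);
* (ii-c) `𝔩𝔬𝔤_{TF,TF} ≅ 𝟭` (the identity ON THE NOSE in the tree's realisation `k~ = (k,+)`,
  abc-iut-L4-t10) and `𝔩𝔬𝔤_{TM,TM} ≅ 𝟭` (`HolMonoidPair.logTMIsoId`), hence both are equivalences.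

HONEST SCOPE: model-level over the named interface (model ≠ reconstruction: the interface datum on the
geometric carriers is abc-iut-L4-t14's `geometricAutHolFieldFunctor`, whose `𝒜_φ = id`); the `sB`
variants are not part of item (ii).  Refereed pre-IUT anabelian geometry; nothing here bears on
[IUTchIII] Cor. 3.12 or takes a side; typed ≠ proved except where a proof is given.
-/

namespace Literature.AnabelianGeometry.AbsoluteAnabelian

open _root_.CategoryTheory

universe u

namespace AbsTopIII

variable (𝔄 : AutHolFieldFunctor.{u})

/-! ### The printed clauses, one by one, for every interface datum -/

/-- **(ii-a)** "the equivalence of categories `κ_LH : EA ⥲ LinHol` … determines": `𝔩𝔬𝔤_{TM,TF}` is, by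
construction, forget-to-`EA`, then `κ_LH`, then `φ_LH : LinHol → 𝒞^hol_TF`, then `𝔩𝔬𝔤_{TF,TF}`; and `κ_LH` is an
equivalence (Def 4.1 (v), abc-iut-L4-t10's `LinHol.κLH_isEquivalence`).
[cite: MochizukiAbsTopIII2015, Proposition 4.2 (ii) p.105] -/
theorem logTMTF_eq :
    HolMonoidPair.logTMTF 𝔄 =
        HolMonoidPair.toEA 𝔄 .TM ⋙ LinHol.κLH 𝔄 ⋙ LinHol.φLH 𝔄 ⋙ HolTFPair.logFunctor 𝔄 ∧
      (LinHol.κLH 𝔄).IsEquivalence :=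
  ⟨rfl, LinHol.κLH_isEquivalence 𝔄⟩

/-- **(ii-b), `T = TF`**: the composite `𝒞^hol_TF → 𝒞^hol_TM →^{𝔩𝔬𝔤_{TM,TF}} 𝒞^hol_TF` (first arrow the natural
functor of Def 4.1 (iii)) is naturally isomorphic to `𝔩𝔬𝔤_{TF,TF}` (abc-iut-w5-d226's `logFactorTF`).
[cite: MochizukiAbsTopIII2015, Proposition 4.2 (ii) p.105] -/
theorem logFactor_TF :
    Nonempty (HolMonoidPair.ofTF 𝔄 ArchPairType.isMonoidType_TM ⋙ HolMonoidPair.logTMTF 𝔄 ≅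
      HolTFPair.logFunctor 𝔄) :=
  ⟨HolMonoidPair.logFactorTF 𝔄⟩

/-- **(ii-b), `T ∈ {TM, TLG, TCG}`**: the composite `𝒞^hol_TF → 𝒞^hol_TM →^{𝔩𝔬𝔤_{TM,T}} 𝒞^hol_T` is naturally
isomorphic to `𝔩𝔬𝔤_{TF,T}` (abc-iut-w5-d226's `logFactor`). [cite: MochizukiAbsTopIII2015, Proposition 4.2 (ii) p.105] -/
theorem logFactor_monoid {T : ArchPairType} (hT : T.IsMonoidType) :
    Nonempty (HolMonoidPair.ofTF 𝔄 ArchPairType.isMonoidType_TM ⋙ HolMonoidPair.logTM 𝔄 hT ≅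
      HolMonoidPair.logTF 𝔄 hT) :=
  ⟨HolMonoidPair.logFactor 𝔄 hT⟩

/-- **(ii-c), `T = TF`**: "`𝔩𝔬𝔤_{TF,TF}` is isomorphic to the identity functor [hence … an equivalence]" — in
the tree's realisation `k~ = (k,+)` it IS the identity functor (abc-iut-L4-t10's `HolTFPair.logFunctor`).
[cite: MochizukiAbsTopIII2015, Proposition 4.2 (ii) p.106] -/
theorem logFunctor_TF_iso_id :
    Nonempty (HolTFPair.logFunctor 𝔄 ≅ 𝟭 (HolTFPair 𝔄)) ∧ (HolTFPair.logFunctor 𝔄).IsEquivalence :=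
  ⟨⟨Iso.refl _⟩, Functor.isEquivalence_refl⟩

/-- **(ii-c), `T = TM`**: "`𝔩𝔬𝔤_{TM,TM}` is isomorphic to the identity functor [hence … an equivalence]"
(abc-iut-w5-d226's `logTMIsoId`, `logTM_TM_isEquivalence`). [cite: MochizukiAbsTopIII2015, Proposition 4.2 (ii) p.106] -/
theorem logFunctor_TM_iso_id :
    Nonempty (HolMonoidPair.logTM 𝔄 ArchPairType.isMonoidType_TM ≅ 𝟭 (HolMonoidPair 𝔄 .TM)) ∧
      (HolMonoidPair.logTM 𝔄 ArchPairType.isMonoidType_TM).IsEquivalence :=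
  ⟨⟨HolMonoidPair.logTMIsoId 𝔄⟩, HolMonoidPair.logTM_TM_isEquivalence⟩

/-! ### Item (ii) as one statement, zero binders -/

/-- **[AbsTopIII] Prop 4.2 (ii) at the archimedean MODEL of §4, for EVERY interface datum
`𝔄 : AutHolFieldFunctor`, with NO further hypothesis** — all printed clauses: (ii-a) `𝔩𝔬𝔤_{TM,TF}` is
determined by `κ_LH` (an equivalence); (ii-b) for each of the four types `T ∈ {TF, TLG, TCG, TM}` the
composite `𝒞^hol_TF → 𝒞^hol_TM →^{𝔩𝔬𝔤_{TM,T}} 𝒞^hol_T` is naturally isomorphic to `𝔩𝔬𝔤_{TF,T}`; (ii-c) for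
`T ∈ {TF, TM}`, `𝔩𝔬𝔤_{T,T} ≅ 𝟭`, hence an equivalence of categories.
[cite: MochizukiAbsTopIII2015, Proposition 4.2 (ii) pp.105–106] -/
theorem prop_4_2_ii_arch :
    (HolMonoidPair.logTMTF 𝔄 =
          HolMonoidPair.toEA 𝔄 .TM ⋙ LinHol.κLH 𝔄 ⋙ LinHol.φLH 𝔄 ⋙ HolTFPair.logFunctor 𝔄 ∧
        (LinHol.κLH 𝔄).IsEquivalence) ∧
      Nonempty (HolMonoidPair.ofTF 𝔄 ArchPairType.isMonoidType_TM ⋙ HolMonoidPair.logTMTF 𝔄 ≅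
        HolTFPair.logFunctor 𝔄) ∧
      (∀ (T : ArchPairType) (hT : T.IsMonoidType),
        Nonempty (HolMonoidPair.ofTF 𝔄 ArchPairType.isMonoidType_TM ⋙ HolMonoidPair.logTM 𝔄 hT ≅
          HolMonoidPair.logTF 𝔄 hT)) ∧
      (Nonempty (HolTFPair.logFunctor 𝔄 ≅ 𝟭 (HolTFPair 𝔄)) ∧ (HolTFPair.logFunctor 𝔄).IsEquivalence) ∧
      (Nonempty (HolMonoidPair.logTM 𝔄 ArchPairType.isMonoidType_TM ≅ 𝟭 (HolMonoidPair 𝔄 .TM)) ∧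
        (HolMonoidPair.logTM 𝔄 ArchPairType.isMonoidType_TM).IsEquivalence) :=
  ⟨logTMTF_eq 𝔄, logFactor_TF 𝔄, fun _ hT => logFactor_monoid 𝔄 hT, logFunctor_TF_iso_id 𝔄,
    logFunctor_TM_iso_id 𝔄⟩

/-! ### … read at the tree's model families of the interface -/

/-- Prop 4.2 (ii) at the archimedean model over EVERY constant-field datum `EA := E` (`𝒜_𝕏 = ℂ`,
`𝒜_φ = id`), zero binders. [cite: MochizukiAbsTopIII2015, Proposition 4.2 (ii) pp.105–106] -/
theorem prop_4_2_ii_ofConstField (E : Type 1) [Category.{1} E] :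
    let 𝔄 := AutHolFieldFunctor.ofConstField E
    (HolMonoidPair.logTMTF 𝔄 =
          HolMonoidPair.toEA 𝔄 .TM ⋙ LinHol.κLH 𝔄 ⋙ LinHol.φLH 𝔄 ⋙ HolTFPair.logFunctor 𝔄 ∧
        (LinHol.κLH 𝔄).IsEquivalence) ∧
      Nonempty (HolMonoidPair.ofTF 𝔄 ArchPairType.isMonoidType_TM ⋙ HolMonoidPair.logTMTF 𝔄 ≅
        HolTFPair.logFunctor 𝔄) ∧
      (∀ (T : ArchPairType) (hT : T.IsMonoidType),
        Nonempty (HolMonoidPair.ofTF 𝔄 ArchPairType.isMonoidType_TM ⋙ HolMonoidPair.logTM 𝔄 hT ≅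
          HolMonoidPair.logTF 𝔄 hT)) ∧
      (Nonempty (HolTFPair.logFunctor 𝔄 ≅ 𝟭 (HolTFPair 𝔄)) ∧ (HolTFPair.logFunctor 𝔄).IsEquivalence) ∧
      (Nonempty (HolMonoidPair.logTM 𝔄 ArchPairType.isMonoidType_TM ≅ 𝟭 (HolMonoidPair 𝔄 .TM)) ∧
        (HolMonoidPair.logTM 𝔄 ArchPairType.isMonoidType_TM).IsEquivalence) :=
  prop_4_2_ii_arch _

/-- **Prop 4.2 (ii) at the Galois-category instance `EA = B(Π)` for EVERY topological group `Π`, with NO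
slimness hypothesis** (slimness / Lemma 4.3 serves the id-rigidity clause of item (i) only).
[cite: MochizukiAbsTopIII2015, Proposition 4.2 (ii) pp.105–106] -/
theorem prop_4_2_ii_ofGaloisCategory (G : Type) [Group G] [TopologicalSpace G] :
    let 𝔄 := AutHolFieldFunctor.ofGaloisCategory G
    (HolMonoidPair.logTMTF 𝔄 =
          HolMonoidPair.toEA 𝔄 .TM ⋙ LinHol.κLH 𝔄 ⋙ LinHol.φLH 𝔄 ⋙ HolTFPair.logFunctor 𝔄 ∧
        (LinHol.κLH 𝔄).IsEquivalence) ∧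
      Nonempty (HolMonoidPair.ofTF 𝔄 ArchPairType.isMonoidType_TM ⋙ HolMonoidPair.logTMTF 𝔄 ≅
        HolTFPair.logFunctor 𝔄) ∧
      (∀ (T : ArchPairType) (hT : T.IsMonoidType),
        Nonempty (HolMonoidPair.ofTF 𝔄 ArchPairType.isMonoidType_TM ⋙ HolMonoidPair.logTM 𝔄 hT ≅
          HolMonoidPair.logTF 𝔄 hT)) ∧
      (Nonempty (HolTFPair.logFunctor 𝔄 ≅ 𝟭 (HolTFPair 𝔄)) ∧ (HolTFPair.logFunctor 𝔄).IsEquivalence) ∧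
      (Nonempty (HolMonoidPair.logTM 𝔄 ArchPairType.isMonoidType_TM ≅ 𝟭 (HolMonoidPair 𝔄 .TM)) ∧
        (HolMonoidPair.logTM 𝔄 ArchPairType.isMonoidType_TM).IsEquivalence) :=
  prop_4_2_ii_arch _

end AbsTopIII

namespace HolRS

/-- **[AbsTopIII] Prop 4.2 (ii) at the GEOMETRIC model for EVERY object property `Q` of connected Riemann
surfaces** — `EA = EA^hol_RS(Q)` (abc-iut-L4-t14's `geometricAutHolFieldFunctor Q`: holomorphic finite
étale morphisms, `𝒜_𝕏 = ℂ`, `𝒜_φ = id`), in particular for print's elliptically admissible hyperbolic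
orbicurves over CAF's — with NO id-rigidity / Lemma-4.3 input.
[cite: MochizukiAbsTopIII2015, Proposition 4.2 (ii) pp.105–106] -/
theorem prop_4_2_ii_geometric (Q : ObjectProperty HolRS) :
    let 𝔄 := geometricAutHolFieldFunctor Q
    (HolMonoidPair.logTMTF 𝔄 =
          HolMonoidPair.toEA 𝔄 .TM ⋙ LinHol.κLH 𝔄 ⋙ LinHol.φLH 𝔄 ⋙ HolTFPair.logFunctor 𝔄 ∧
        (LinHol.κLH 𝔄).IsEquivalence) ∧
      Nonempty (HolMonoidPair.ofTF 𝔄 ArchPairType.isMonoidType_TM ⋙ HolMonoidPair.logTMTF 𝔄 ≅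
        HolTFPair.logFunctor 𝔄) ∧
      (∀ (T : ArchPairType) (hT : T.IsMonoidType),
        Nonempty (HolMonoidPair.ofTF 𝔄 ArchPairType.isMonoidType_TM ⋙ HolMonoidPair.logTM 𝔄 hT ≅
          HolMonoidPair.logTF 𝔄 hT)) ∧
      (Nonempty (HolTFPair.logFunctor 𝔄 ≅ 𝟭 (HolTFPair 𝔄)) ∧ (HolTFPair.logFunctor 𝔄).IsEquivalence) ∧
      (Nonempty (HolMonoidPair.logTM 𝔄 ArchPairType.isMonoidType_TM ≅ 𝟭 (HolMonoidPair 𝔄 .TM)) ∧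
        (HolMonoidPair.logTM 𝔄 ArchPairType.isMonoidType_TM).IsEquivalence) :=
  AbsTopIII.prop_4_2_ii_arch _

end HolRS

end Literature.AnabelianGeometry.AbsoluteAnabelian
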